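import Literature.Topology.FourManifolds.LatticeFormsOrthoSum
import Literature.Topology.FourManifolds.LatticeFormsSylvester
import Mathlib.LinearAlgebra.Quotient.Bilinear
import Mathlib.RingTheory.Finiteness.Prod
import HarnessLib

/-!
# The index of an orthogonal sum of lattices: `τ(E₁ ⊕ E₂) = τ(E₁) + τ(E₂)`

Trunk T-4MAN; companion of `LatticeFormsOrthoSum.lean` (which introduces the orthogonal sum
`LinearMap.BilinForm.prod` and explicitly leaves the additivity of the index unproved) and of
`LatticeFormsSylvester.lean` (orthogonalisation inside a lattice).

J.-P. Serre, *A Course in Arithmetic* (GTM 7, 1973), Ch. V §1.3.7: for `E = E₁ ⊕ E₂`,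
"`r(E) = r(E₁) + r(E₂)`, `τ(E) = τ(E₁) + τ(E₂)`", where the index `τ(E) = r − s` is read off
from the signature `(r, s)` of `E ⊗ 𝐑` (§1.3.2).  R. Thom, *Quelques propriétés globales des
variétés différentiables*, Comment. Math. Helv. 28 (1954), Ch. IV §2, p. 65: "cet invariant `τ` …
se comporte additivement" — the algebraic half of the additivity of the signature of manifolds
under disjoint union.

Here `b⁺ = sigPos`, `b⁻ = sigNeg` are Mathlib's maximal ranks of positive / negative definite
*submodules* (over `ℤ`: sublattices), and the statement proved is, for **symmetric** bilinear
forms `B₁`, `B₂` on finitely generated modules over a linearly ordered Noetherian ring `R` (e.g.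
`ℤ`), with no nondegeneracy or freeness hypothesis:
`sigPos (B₁ ⊕ B₂) = sigPos B₁ + sigPos B₂`, `sigNeg (B₁ ⊕ B₂) = sigNeg B₁ + sigNeg B₂`
(`sigPos_prod`, `sigNeg_prod`), hence over `ℤ` `(B₁.prod B₂).signature = B₁.signature +
B₂.signature` (`signature_prod`).  The proof never leaves `R` (no base change to a field):

* `sigPos_eq_card_of_orthogonal`: for *any* bilinear form, an orthogonal family of `rank V`
  vectors of nonzero square computes `b⁺` and `b⁻` as the numbers of positive and of negative
  squares (from `card_pos_le_sigPos` and `b⁺ + b⁻ ≤ rank` of `LatticeFormsSylvester.lean`);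
* `sigPos_le_sigPos_of_comp`: a linear map `φ` with `B' (φ x) (φ y) = B x y` cannot decrease
  `b⁺` (it is injective on positive definite submodules);
* `exists_quotKerForm`: a symmetric form descends to a *nondegenerate* symmetric form `B̄` on
  `V ⧸ ker B` (Mathlib's `LinearMap.liftQ₂`; kept as an existence statement, no definition),
  where `LatticeFormsSylvester.exists_orthogonal_of_isSymm` supplies an orthogonal family of
  `rank (V ⧸ ker B)` vectors of nonzero square; lifting it to `V` shows `b±(B) = b±(B̄) =` the
  number of positive / negative squares (`exists_orthogonal_card_eq`,
  `sigPos_eq_sigPos_of_quotKerForm`);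
* for `B₁ ⊕ B₂` the two lifted families juxtapose to an orthogonal family of
  `rank (V₁ ⧸ ker B₁) + rank (V₂ ⧸ ker B₂)` vectors, which computes `b±(B̄₁ ⊕ B̄₂)`; squeezing
  `b±(B₁) + b±(B₂) ≤ b±(B₁ ⊕ B₂) ≤ b±(B̄₁ ⊕ B̄₂)` gives the additivity.

Everything is proved; no definitions, no named facts.  All declarations are deliberate
dot-notation extensions of Mathlib's namespace `LinearMap.BilinForm`, as in `LatticeForms.lean`;
no name clashes with Mathlib (checked `lean search 'sigPos_prod|signature_prod|quotKerForm'`).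

## References

* J.-P. Serre, *A Course in Arithmetic*, GTM 7, Springer 1973, Ch. IV §1.4 Thm. 1, §2.4; Ch. V
  §1.3.2, §1.3.7. [Serre1973]
* J. Milnor, D. Husemoller, *Symmetric bilinear forms*, Springer 1973, Ch. I §3 (orthogonal
  sums), Ch. II §2 (signature). [MilnorHusemoller1973]
* R. Thom, Comment. Math. Helv. 28 (1954), Ch. IV §2, p. 65. [ThomCMH1954]
-/

noncomputable section

open Module

universe u u' v

namespace LinearMap.BilinForm

section General

variable {R : Type v} [CommRing R]
variable {V : Type u} [AddCommGroup V] [Module R V]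
variable {V' : Type u'} [AddCommGroup V'] [Module R V']

/-! ### The nondegenerate quotient `V ⧸ ker B` of a symmetric form -/

/-- For a symmetric form the (left) kernel `ker B = {x | ∀ y, B x y = 0}` is also the right
kernel, so `B` vanishes on `ker B` in the second variable. [folklore] -/
lemma ker_le_ker_flip {B : LinearMap.BilinForm R V} (hB : B.IsSymm) :
    LinearMap.ker B ≤ LinearMap.ker (LinearMap.flip B) := by
  intro x hx
  rw [LinearMap.mem_ker] at hx ⊢
  ext y
  rw [LinearMap.flip_apply, hB.eq y x, hx]

/-- The **radical quotient** of a symmetric bilinear form: `B` descends to a bilinear form `B̄`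
on `V ⧸ ker B` with `B̄ [x] [y] = B x y` (Serre, *A Course in Arithmetic*, Ch. IV §1.2: the
quotient of a quadratic module by its radical `V⁰`; Mathlib's `LinearMap.liftQ₂`).  Stated as an
existence so that no definition is introduced; the lemmas below take any such `B̄` as a
parameter `B'` with `hB' : ∀ x y, B' [x] [y] = B x y`. [cite: Serre1973, Ch. IV §1.2] -/
lemma exists_quotKerForm (B : LinearMap.BilinForm R V) (hB : B.IsSymm) :
    ∃ B' : LinearMap.BilinForm R (V ⧸ LinearMap.ker B),
      ∀ x y, B' (Submodule.Quotient.mk x) (Submodule.Quotient.mk y) = B x y :=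
  ⟨B.liftQ₂ (LinearMap.ker B) (LinearMap.ker B) le_rfl (ker_le_ker_flip hB), fun _ _ => rfl⟩

/-- A radical quotient form of a symmetric form is symmetric. [cite: Serre1973, Ch. IV §1.2] -/
lemma isSymm_of_quotKerForm {B : LinearMap.BilinForm R V} (hB : B.IsSymm)
    {B' : LinearMap.BilinForm R (V ⧸ LinearMap.ker B)}
    (hB' : ∀ x y, B' (Submodule.Quotient.mk x) (Submodule.Quotient.mk y) = B x y) :
    B'.IsSymm := by
  rw [LinearMap.BilinForm.isSymm_def]
  intro x y
  induction x using Submodule.Quotient.induction_on with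
  | H x =>
    induction y using Submodule.Quotient.induction_on with
    | H y => rw [hB', hB', hB.eq]

/-- A radical quotient form is nondegenerate: a class pairing to zero with every class comes
from `ker B` (Serre, *A Course in Arithmetic*, Ch. IV §1.2). [cite: Serre1973, Ch. IV §1.2] -/
lemma nondegenerate_of_quotKerForm {B : LinearMap.BilinForm R V}
    {B' : LinearMap.BilinForm R (V ⧸ LinearMap.ker B)}
    (hB' : ∀ x y, B' (Submodule.Quotient.mk x) (Submodule.Quotient.mk y) = B x y)
    (x : V ⧸ LinearMap.ker B) (hx : ∀ y, B' x y = 0) : x = 0 := by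
  induction x using Submodule.Quotient.induction_on with
  | H x =>
    rw [Submodule.Quotient.mk_eq_zero, LinearMap.mem_ker]
    ext y
    rw [LinearMap.zero_apply, ← hB' x y]
    exact hx _

/-! ### Products: rank and juxtaposed orthogonal families -/

/-- `rank (V × V') = rank V + rank V'` for finitely generated modules over a ring satisfying the
rank–nullity theorem (e.g. a commutative domain; Mathlib's `Module.finrank_prod` assumes free
modules): rank–nullity for the projection `V × V' → V'`, whose kernel is `V`. [folklore] -/
lemma finrank_prod_eq [IsDomain R] [Module.Finite R V] [Module.Finite R V'] :
    finrank R (V × V') = finrank R V + finrank R V' := by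
  have h := Submodule.finrank_quotient_add_finrank (LinearMap.ker (LinearMap.snd R V V'))
  have e₁ : ((V × V') ⧸ LinearMap.ker (LinearMap.snd R V V')) ≃ₗ[R] V' :=
    LinearMap.quotKerEquivOfSurjective _ Prod.snd_surjective
  have e₂ : V ≃ₗ[R] LinearMap.ker (LinearMap.snd R V V') :=
    (LinearEquiv.ofInjective _ LinearMap.inl_injective).trans
      (LinearEquiv.ofEq _ _ (LinearMap.ker_snd (R := R) (M := V) (M₂ := V')).symm)
  rw [e₁.finrank_eq, ← e₂.finrank_eq] at h
  omega

/-- Juxtaposing a `B₁`-orthogonal family of `V₁` and a `B₂`-orthogonal family of `V₂` gives a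
`B₁ ⊕ B₂`-orthogonal family of `V₁ × V₂` (Serre, *A Course in Arithmetic*, Ch. V §1.2: `E` and
`E'` are orthogonal in `E ⊕ E'`). [cite: Serre1973, Ch. V §1.2] -/
lemma pairwise_prod_sumElim_eq_zero (B₁ : LinearMap.BilinForm R V) (B₂ : LinearMap.BilinForm R V')
    {ι₁ ι₂ : Type*} {f₁ : ι₁ → V} {f₂ : ι₂ → V'}
    (h₁ : Pairwise fun i j => B₁ (f₁ i) (f₁ j) = 0) (h₂ : Pairwise fun i j => B₂ (f₂ i) (f₂ j) = 0) :
    Pairwise fun i j => (B₁.prod B₂) (Sum.elim (fun i => (f₁ i, 0)) (fun i => (0, f₂ i)) i)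
      (Sum.elim (fun i => (f₁ i, 0)) (fun i => (0, f₂ i)) j) = 0 := by
  rintro (i | i) (j | j) hij
  · have hij' : i ≠ j := fun h => hij (congrArg Sum.inl h)
    simp [prod_apply, h₁ hij']
  · simp [prod_apply]
  · simp [prod_apply]
  · have hij' : i ≠ j := fun h => hij (congrArg Sum.inr h)
    simp [prod_apply, h₂ hij']

/-- Squares in the juxtaposed family are the squares in the factors. [cite: Serre1973, Ch. V §1.2] -/
lemma prod_sumElim_self (B₁ : LinearMap.BilinForm R V) (B₂ : LinearMap.BilinForm R V')
    {ι₁ ι₂ : Type*} (f₁ : ι₁ → V) (f₂ : ι₂ → V') (i : ι₁ ⊕ ι₂) :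
    (B₁.prod B₂) (Sum.elim (fun i => (f₁ i, 0)) (fun i => (0, f₂ i)) i)
        (Sum.elim (fun i => (f₁ i, 0)) (fun i => (0, f₂ i)) i) =
      Sum.elim (fun i => B₁ (f₁ i) (f₁ i)) (fun i => B₂ (f₂ i) (f₂ i)) i := by
  rcases i with i | i <;> simp [prod_apply]

/-- Counting members of positive (or negative) square in a juxtaposed family. [folklore] -/
lemma card_subtype_sumElim {α : Type*} {ι₁ ι₂ : Type*} [Fintype ι₁] [Fintype ι₂] (a₁ : ι₁ → α)
    (a₂ : ι₂ → α) (p : α → Prop) [DecidablePred p] :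
    Fintype.card {i // p (Sum.elim a₁ a₂ i)} =
      Fintype.card {i // p (a₁ i)} + Fintype.card {i // p (a₂ i)} := by
  rw [Fintype.card_subtype, Fintype.card_subtype, Fintype.card_subtype]
  rw [← Finset.card_disjSum]
  congr 1
  ext (i | i) <;> simp

end General

section Ordered

variable {R : Type v} [CommRing R] [LinearOrder R] [IsStrictOrderedRing R]
variable {V : Type u} [AddCommGroup V] [Module R V]
variable {V' : Type u'} [AddCommGroup V'] [Module R V']

/-! ### Counting squares of an orthogonal family of full size -/

/-- **`b⁺` and `b⁻` from an orthogonal family of full size.**  For any bilinear form `B` on a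
finitely generated module `V` over a linearly ordered domain, a pairwise `B`-orthogonal family of
`rank V` vectors of nonzero square has exactly `b⁺(B)` members of positive square and `b⁻(B)`
members of negative square (Serre, *A Course in Arithmetic*, Ch. IV §2.4: in an orthogonal basis
the form is `Σ aᵢ Xᵢ²` and `(r, s)` counts the signs of the `aᵢ`; here from `card_pos_le_sigPos`
and `b⁺ + b⁻ ≤ rank`).  The family need not be a basis (over `ℤ` it spans a sublattice of finite
index). [cite: Serre1973, Ch. IV §2.4] -/
theorem sigPos_eq_card_of_orthogonal [Module.Finite R V] (B : LinearMap.BilinForm R V)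
    {ι : Type*} [Fintype ι] (f : ι → V) (horth : Pairwise fun i j => B (f i) (f j) = 0)
    (h0 : ∀ i, B (f i) (f i) ≠ 0) (hcard : Fintype.card ι = finrank R V) :
    sigPos B.toQuadraticMap = Fintype.card {i // 0 < B (f i) (f i)} ∧
      sigNeg B.toQuadraticMap = Fintype.card {i // B (f i) (f i) < 0} := by
  have hp := card_pos_le_sigPos B f horth
  have hn := card_pos_le_sigPos (-B) f fun i j hij => by
    show (-B) (f i) (f j) = 0
    rw [LinearMap.neg_apply, LinearMap.neg_apply, horth hij, neg_zero]
  rw [show (-B).toQuadraticMap = -B.toQuadraticMap from rfl, sigPos_neg] at hn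
  have e : {i // 0 < (-B) (f i) (f i)} ≃ {i // B (f i) (f i) < 0} :=
    Equiv.subtypeEquivRight fun i => by
      rw [LinearMap.neg_apply, LinearMap.neg_apply, neg_pos]
  rw [Fintype.card_congr e] at hn
  have hsplit : Fintype.card {i // 0 < B (f i) (f i)} + Fintype.card {i // B (f i) (f i) < 0} =
      Fintype.card ι := by
    have e' : {i // B (f i) (f i) < 0} ≃ {i // ¬ 0 < B (f i) (f i)} :=
      Equiv.subtypeEquivRight fun i => by
        rw [not_lt]
        exact ⟨le_of_lt, fun h => lt_of_le_of_ne h (h0 i)⟩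
    rw [Fintype.card_congr e', Fintype.card_subtype_compl]
    have := Fintype.card_subtype_le fun i => 0 < B (f i) (f i)
    omega
  have hle := sigPos_add_sigNeg_le_finrank B.toQuadraticMap
  omega

/-! ### Isometric linear maps do not decrease `b⁺` -/

/-- A linear map `φ : V → V'` compatible with the forms, `B' (φ x) (φ y) = B x y`, is injective on
every positive definite submodule `P` of `V` (a vector of `P` killed by `φ` has square `0`) and
maps it onto a positive definite submodule of `V'` of the same rank; hence `b⁺(B) ≤ b⁺(B')`
(Serre, *A Course in Arithmetic*, Ch. IV §2.4 / Ch. V §1.3.2: the index only depends on the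
induced real form; Milnor–Husemoller 1973, Ch. II §2). [cite: Serre1973, Ch. V §1.3.2] -/
theorem sigPos_le_sigPos_of_comp [Module.Finite R V] [Module.Finite R V']
    (B : LinearMap.BilinForm R V) (B' : LinearMap.BilinForm R V') (φ : V →ₗ[R] V')
    (hφ : ∀ x y, B' (φ x) (φ y) = B x y) :
    sigPos B.toQuadraticMap ≤ sigPos B'.toQuadraticMap := by
  obtain ⟨P, hP, hpos⟩ := exists_finrank_eq_sigPos_and_posDef B.toQuadraticMap
  -- `φ` restricted to `P` is injective
  set ψ : P →ₗ[R] V' := φ.comp P.subtype with hψ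
  have hinj : Function.Injective ψ := by
    rw [injective_iff_map_eq_zero]
    intro p hp0
    by_contra hne
    have h1 : 0 < B.toQuadraticMap (p : V) := hpos p hne
    rw [LinearMap.BilinMap.toQuadraticMap_apply, ← hφ] at h1
    have h2 : φ (p : V) = 0 := hp0
    rw [h2] at h1
    simp at h1
  -- its image is positive definite
  have hpos' : (B'.toQuadraticMap.restrict (LinearMap.range ψ)).PosDef := by
    intro v hv
    obtain ⟨p, hp'⟩ := (LinearMap.mem_range).mp v.2
    have hpne : p ≠ 0 := by
      rintro rfl
      apply hv
      ext
      rw [← hp', map_zero]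
      rfl
    change 0 < B'.toQuadraticMap (v : V')
    rw [← hp', LinearMap.BilinMap.toQuadraticMap_apply, hψ, LinearMap.comp_apply, hφ]
    exact hpos p hpne
  calc sigPos B.toQuadraticMap = finrank R P := hP.symm
    _ = finrank R ↥(LinearMap.range ψ) := (LinearMap.finrank_range_of_inj hinj).symm
    _ ≤ sigPos B'.toQuadraticMap := le_sigPos_of_posDef _ hpos'

/-- `b⁻(B) ≤ b⁻(B')` for a linear map compatible with the forms (apply `sigPos_le_sigPos_of_comp`
to `-B`, `-B'`). [cite: Serre1973, Ch. V §1.3.2] -/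
theorem sigNeg_le_sigNeg_of_comp [Module.Finite R V] [Module.Finite R V']
    (B : LinearMap.BilinForm R V) (B' : LinearMap.BilinForm R V') (φ : V →ₗ[R] V')
    (hφ : ∀ x y, B' (φ x) (φ y) = B x y) :
    sigNeg B.toQuadraticMap ≤ sigNeg B'.toQuadraticMap := by
  have h := sigPos_le_sigPos_of_comp (-B) (-B') φ fun x y => by
    simp only [LinearMap.neg_apply, hφ]
  rwa [show (-B).toQuadraticMap = -B.toQuadraticMap from rfl,
    show (-B').toQuadraticMap = -B'.toQuadraticMap from rfl, sigPos_neg, sigPos_neg] at h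

/-- **Orthogonalisation of a symmetric form modulo its kernel.**  A symmetric bilinear form `B`
on a finitely generated module over a linearly ordered Noetherian ring admits a pairwise
orthogonal family `f` of `rank (V ⧸ ker B)` vectors of nonzero square, and `b⁺(B)` (resp.
`b⁻(B)`) is the number of members of `f` of positive (resp. negative) square (Serre, *A Course in
Arithmetic*, Ch. IV §1.4 Thm. 1 with §1.2 and §2.4: orthogonal basis of `V/V⁰`, signature read
off from the squares).  Proof: orthogonalise a radical quotient form `B̄` inside `V ⧸ ker B`
(`exists_orthogonal_of_isSymm`), lift, and squeeze `#pos ≤ b⁺(B) ≤ b⁺(B̄) = #pos`.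
[cite: Serre1973, Ch. IV §1.4 Thm. 1 and §2.4] -/
theorem exists_orthogonal_card_eq [IsNoetherianRing R] [Module.Finite R V]
    (B : LinearMap.BilinForm R V) (hB : B.IsSymm) :
    ∃ (ι : Type) (_ : Fintype ι) (f : ι → V),
      Fintype.card ι = finrank R (V ⧸ LinearMap.ker B) ∧ (∀ i, B (f i) (f i) ≠ 0) ∧
      (Pairwise fun i j => B (f i) (f j) = 0) ∧
      sigPos B.toQuadraticMap = Fintype.card {i // 0 < B (f i) (f i)} ∧
      sigNeg B.toQuadraticMap = Fintype.card {i // B (f i) (f i) < 0} := by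
  obtain ⟨B', hB'⟩ := exists_quotKerForm B hB
  obtain ⟨ι, _, f', hcard, hsq, horth⟩ := exists_orthogonal_of_isSymm _ (V ⧸ LinearMap.ker B)
    B' (isSymm_of_quotKerForm hB hB') (nondegenerate_of_quotKerForm hB') le_rfl
  -- lift the family to `V`
  choose f hf using fun i => Submodule.Quotient.mk_surjective (LinearMap.ker B) (f' i)
  have hff : ∀ i j, B (f i) (f j) = B' (f' i) (f' j) := fun i j => by
    rw [← hf i, ← hf j, hB']
  have hsqV : ∀ i, B (f i) (f i) ≠ 0 := fun i => by rw [hff]; exact hsq i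
  have horthV : Pairwise fun i j => B (f i) (f j) = 0 := fun i j hij => by
    show B (f i) (f j) = 0
    rw [hff]
    exact horth hij
  obtain ⟨hp'', hn''⟩ := sigPos_eq_card_of_orthogonal B' f' horth hsq hcard
  have hposeq : Fintype.card {i // 0 < B' (f' i) (f' i)} =
      Fintype.card {i // 0 < B (f i) (f i)} :=
    Fintype.card_congr (Equiv.subtypeEquivRight fun i => by rw [hff])
  have hnegeq : Fintype.card {i // B' (f' i) (f' i) < 0} =
      Fintype.card {i // B (f i) (f i) < 0} :=
    Fintype.card_congr (Equiv.subtypeEquivRight fun i => by rw [hff])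
  have hp' : sigPos B'.toQuadraticMap = Fintype.card {i // 0 < B (f i) (f i)} :=
    hp''.trans hposeq
  have hn' : sigNeg B'.toQuadraticMap = Fintype.card {i // B (f i) (f i) < 0} :=
    hn''.trans hnegeq
  have hp := card_pos_le_sigPos B f horthV
  have hn := card_pos_le_sigPos (-B) f fun i j hij => by
    show (-B) (f i) (f j) = 0
    rw [LinearMap.neg_apply, LinearMap.neg_apply, horthV hij, neg_zero]
  rw [show (-B).toQuadraticMap = -B.toQuadraticMap from rfl, sigPos_neg,
    Fintype.card_congr (Equiv.subtypeEquivRight fun i => by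
      rw [LinearMap.neg_apply, LinearMap.neg_apply, neg_pos] :
        {i // 0 < (-B) (f i) (f i)} ≃ {i // B (f i) (f i) < 0})] at hn
  have hle : sigPos B.toQuadraticMap ≤ sigPos B'.toQuadraticMap :=
    sigPos_le_sigPos_of_comp B B' (LinearMap.ker B).mkQ hB'
  have hle' : sigNeg B.toQuadraticMap ≤ sigNeg B'.toQuadraticMap :=
    sigNeg_le_sigNeg_of_comp B B' (LinearMap.ker B).mkQ hB'
  exact ⟨ι, inferInstance, f, hcard, hsqV, horthV, by omega, by omega⟩

/-- `b⁺(B) = b⁺(B̄)` and `b⁻(B) = b⁻(B̄)` for any radical quotient form `B̄` of a symmetric form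
`B`: the maximal ranks of definite submodules are those of the nondegenerate quotient (Serre,
*A Course in Arithmetic*, Ch. IV §1.2 with §2.4). [cite: Serre1973, Ch. IV §1.2 and §2.4] -/
theorem sigPos_eq_sigPos_of_quotKerForm [IsNoetherianRing R] [Module.Finite R V]
    {B : LinearMap.BilinForm R V} (hB : B.IsSymm)
    {B' : LinearMap.BilinForm R (V ⧸ LinearMap.ker B)}
    (hB' : ∀ x y, B' (Submodule.Quotient.mk x) (Submodule.Quotient.mk y) = B x y) :
    sigPos B.toQuadraticMap = sigPos B'.toQuadraticMap ∧
      sigNeg B.toQuadraticMap = sigNeg B'.toQuadraticMap := by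
  obtain ⟨ι, _, f, hcard, hsq, horth, hp, hn⟩ := exists_orthogonal_card_eq B hB
  have horth' : Pairwise fun i j => B' ((LinearMap.ker B).mkQ (f i)) ((LinearMap.ker B).mkQ (f j)) = 0 :=
    fun i j hij => by
      show B' ((LinearMap.ker B).mkQ (f i)) ((LinearMap.ker B).mkQ (f j)) = 0
      rw [Submodule.mkQ_apply, Submodule.mkQ_apply, hB']
      exact horth hij
  have hsq' : ∀ i, B' ((LinearMap.ker B).mkQ (f i)) ((LinearMap.ker B).mkQ (f i)) ≠ 0 := fun i => by
    rw [Submodule.mkQ_apply, hB']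
    exact hsq i
  obtain ⟨hp', hn'⟩ := sigPos_eq_card_of_orthogonal B' _ horth' hsq' hcard
  simp only [Submodule.mkQ_apply, hB'] at hp' hn'
  exact ⟨hp.trans hp'.symm, hn.trans hn'.symm⟩

/-! ### Additivity of `b⁺`, `b⁻` under orthogonal sums -/

/-- **Additivity of `b⁺` and `b⁻` under orthogonal sums** of symmetric bilinear forms on finitely
generated modules over a linearly ordered Noetherian ring (Serre, *A Course in Arithmetic*, Ch. V
§1.3.7, "`τ(E₁ ⊕ E₂) = τ(E₁) + τ(E₂)`" together with "`r(E₁ ⊕ E₂) = r(E₁) + r(E₂)`", i.e. the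
signatures `(r, s)` add; Milnor–Husemoller 1973, Ch. II §2).  Proof: juxtapose orthogonal
families computing `b±(B₁)`, `b±(B₂)` (`exists_orthogonal_card_eq`); the juxtaposed family
bounds `b±(B₁ ⊕ B₂)` from below (`card_pos_le_sigPos`) and computes `b±(B̄₁ ⊕ B̄₂)`
(`sigPos_eq_card_of_orthogonal`, its size being `rank (V₁ ⧸ ker B₁) + rank (V₂ ⧸ ker B₂)`), which
bounds `b±(B₁ ⊕ B₂)` from above (`sigPos_le_sigPos_of_comp` along `V₁ × V₂ → V̄₁ × V̄₂`).
[cite: Serre1973, Ch. V §1.3.7] -/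
theorem sigPos_prod_and_sigNeg_prod [IsNoetherianRing R] [Module.Finite R V] [Module.Finite R V']
    (B₁ : LinearMap.BilinForm R V) (B₂ : LinearMap.BilinForm R V') (h₁ : B₁.IsSymm)
    (h₂ : B₂.IsSymm) :
    sigPos (B₁.prod B₂).toQuadraticMap = sigPos B₁.toQuadraticMap + sigPos B₂.toQuadraticMap ∧
      sigNeg (B₁.prod B₂).toQuadraticMap = sigNeg B₁.toQuadraticMap + sigNeg B₂.toQuadraticMap := by
  classical
  obtain ⟨ι₁, _, f₁, hc₁, hsq₁, ho₁, hp₁, hn₁⟩ := exists_orthogonal_card_eq B₁ h₁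
  obtain ⟨ι₂, _, f₂, hc₂, hsq₂, ho₂, hp₂, hn₂⟩ := exists_orthogonal_card_eq B₂ h₂
  set B := B₁.prod B₂ with hBdef
  -- the juxtaposed family in `V₁ × V₂`
  set g : ι₁ ⊕ ι₂ → V × V' := Sum.elim (fun i => (f₁ i, 0)) (fun i => (0, f₂ i)) with hg
  have horth : Pairwise fun i j => B (g i) (g j) = 0 := pairwise_prod_sumElim_eq_zero B₁ B₂ ho₁ ho₂
  have hsq : ∀ i, B (g i) (g i) = Sum.elim (fun i => B₁ (f₁ i) (f₁ i)) (fun i => B₂ (f₂ i) (f₂ i)) i :=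
    prod_sumElim_self B₁ B₂ f₁ f₂
  have hpos : Fintype.card {i // 0 < B (g i) (g i)} =
      Fintype.card {i // 0 < B₁ (f₁ i) (f₁ i)} + Fintype.card {i // 0 < B₂ (f₂ i) (f₂ i)} := by
    rw [Fintype.card_congr (Equiv.subtypeEquivRight fun i => by rw [hsq i]),
      card_subtype_sumElim _ _ (fun a : R => 0 < a)]
  have hneg : Fintype.card {i // B (g i) (g i) < 0} =
      Fintype.card {i // B₁ (f₁ i) (f₁ i) < 0} + Fintype.card {i // B₂ (f₂ i) (f₂ i) < 0} := by
    rw [Fintype.card_congr (Equiv.subtypeEquivRight fun i => by rw [hsq i]),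
      card_subtype_sumElim _ _ (fun a : R => a < 0)]
  -- lower bounds in `V₁ × V₂`
  have hlow := card_pos_le_sigPos B g horth
  have hlow' := card_pos_le_sigPos (-B) g fun i j hij => by
    show (-B) (g i) (g j) = 0
    rw [LinearMap.neg_apply, LinearMap.neg_apply, horth hij, neg_zero]
  rw [show (-B).toQuadraticMap = -B.toQuadraticMap from rfl, sigPos_neg,
    Fintype.card_congr (Equiv.subtypeEquivRight fun i => by
      rw [LinearMap.neg_apply, LinearMap.neg_apply, neg_pos] :
        {i // 0 < (-B) (g i) (g i)} ≃ {i // B (g i) (g i) < 0})] at hlow'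
  -- upper bounds through the product of radical quotients
  obtain ⟨B₁', hB₁'⟩ := exists_quotKerForm B₁ h₁
  obtain ⟨B₂', hB₂'⟩ := exists_quotKerForm B₂ h₂
  set φ : V × V' →ₗ[R] (V ⧸ LinearMap.ker B₁) × (V' ⧸ LinearMap.ker B₂) :=
    (LinearMap.ker B₁).mkQ.prodMap (LinearMap.ker B₂).mkQ with hφ
  have hφB : ∀ x y, (B₁'.prod B₂') (φ x) (φ y) = B x y := fun x y => by
    rw [hφ, LinearMap.prodMap_apply, LinearMap.prodMap_apply, prod_apply, Submodule.mkQ_apply,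
      Submodule.mkQ_apply, Submodule.mkQ_apply, Submodule.mkQ_apply, hB₁', hB₂', hBdef, prod_apply]
  have hup := sigPos_le_sigPos_of_comp B (B₁'.prod B₂') φ hφB
  have hup' := sigNeg_le_sigNeg_of_comp B (B₁'.prod B₂') φ hφB
  -- the image family computes `b±(B̄₁ ⊕ B̄₂)`
  have horth' : Pairwise fun i j => (B₁'.prod B₂') (φ (g i)) (φ (g j)) = 0 := fun i j hij => by
    show (B₁'.prod B₂') (φ (g i)) (φ (g j)) = 0
    rw [hφB]
    exact horth hij
  have hsq' : ∀ i, (B₁'.prod B₂') (φ (g i)) (φ (g i)) ≠ 0 := fun i => by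
    rw [hφB, hsq]
    rcases i with i | i
    · exact hsq₁ i
    · exact hsq₂ i
  have hcard : Fintype.card (ι₁ ⊕ ι₂) =
      finrank R ((V ⧸ LinearMap.ker B₁) × (V' ⧸ LinearMap.ker B₂)) := by
    rw [Fintype.card_sum, finrank_prod_eq, hc₁, hc₂]
  obtain ⟨hP, hN⟩ := sigPos_eq_card_of_orthogonal (B₁'.prod B₂') (fun i => φ (g i)) horth' hsq' hcard
  rw [Fintype.card_congr (Equiv.subtypeEquivRight fun i => by rw [hφB] :
      {i // 0 < (B₁'.prod B₂') (φ (g i)) (φ (g i))} ≃ {i // 0 < B (g i) (g i)})] at hP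
  rw [Fintype.card_congr (Equiv.subtypeEquivRight fun i => by rw [hφB] :
      {i // (B₁'.prod B₂') (φ (g i)) (φ (g i)) < 0} ≃ {i // B (g i) (g i) < 0})] at hN
  constructor <;> omega

/-- **`b⁺(B₁ ⊕ B₂) = b⁺(B₁) + b⁺(B₂)`** for symmetric forms on finitely generated modules
(Serre, *A Course in Arithmetic*, Ch. V §1.3.7). [cite: Serre1973, Ch. V §1.3.7] -/
theorem sigPos_prod [IsNoetherianRing R] [Module.Finite R V] [Module.Finite R V']
    (B₁ : LinearMap.BilinForm R V) (B₂ : LinearMap.BilinForm R V') (h₁ : B₁.IsSymm)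
    (h₂ : B₂.IsSymm) :
    sigPos (B₁.prod B₂).toQuadraticMap = sigPos B₁.toQuadraticMap + sigPos B₂.toQuadraticMap :=
  (sigPos_prod_and_sigNeg_prod B₁ B₂ h₁ h₂).1

/-- **`b⁻(B₁ ⊕ B₂) = b⁻(B₁) + b⁻(B₂)`** for symmetric forms on finitely generated modules
(Serre, *A Course in Arithmetic*, Ch. V §1.3.7). [cite: Serre1973, Ch. V §1.3.7] -/
theorem sigNeg_prod [IsNoetherianRing R] [Module.Finite R V] [Module.Finite R V']
    (B₁ : LinearMap.BilinForm R V) (B₂ : LinearMap.BilinForm R V') (h₁ : B₁.IsSymm)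
    (h₂ : B₂.IsSymm) :
    sigNeg (B₁.prod B₂).toQuadraticMap = sigNeg B₁.toQuadraticMap + sigNeg B₂.toQuadraticMap :=
  (sigPos_prod_and_sigNeg_prod B₁ B₂ h₁ h₂).2

end Ordered

/-! ### The index over `ℤ` -/

section Int

/-! The `ℤ`-specific statements assume only `[AddCommGroup _]`, i.e. the canonical `ℤ`-module
structures `AddCommGroup.toIntModule`, so that the structure on `V × V'` is definitionally the
canonical one (see the note in `LatticeFormsOrthoSum.lean`); `signature_eq_add_of_maps` then
restates the additivity for arbitrary `Module ℤ` instances (any such instance *is* the canonical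
one, `Subsingleton (Module ℤ V)`), in a form mentioning no product type. -/

variable {V V' : Type*} [AddCommGroup V] [AddCommGroup V']

/-- **The index is additive: `τ(E₁ ⊕ E₂) = τ(E₁) + τ(E₂)`** for symmetric bilinear forms on
finitely generated abelian groups (Serre, *A Course in Arithmetic*, Ch. V §1.3.7, for unimodular
lattices via `E ⊗ 𝐑`; Thom 1954, Ch. IV §2, p. 65, "cet invariant `τ` … se comporte
additivement"; here for all symmetric forms, `signature = b⁺ − b⁻` as in `LatticeForms.lean`).
[cite: Serre1973, Ch. V §1.3.7] -/
theorem signature_prod [Module.Finite ℤ V] [Module.Finite ℤ V'] (B₁ : LinearMap.BilinForm ℤ V)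
    (B₂ : LinearMap.BilinForm ℤ V') (h₁ : B₁.IsSymm) (h₂ : B₂.IsSymm) :
    (B₁.prod B₂).signature = B₁.signature + B₂.signature := by
  obtain ⟨hp, hn⟩ := sigPos_prod_and_sigNeg_prod B₁ B₂ h₁ h₂
  rw [signature, signature, signature, hp, hn, Nat.cast_add, Nat.cast_add]
  ring

/-- **Additivity of the index along a decomposition `W ≅ V ⊕ V'`**, for arbitrary `Module ℤ`
instances and without naming the product module: if `π₁ : W → V`, `π₂ : W → V'` are jointly
bijective linear maps and `Q x y = B₁ (π₁ x) (π₁ y) + B₂ (π₂ x) (π₂ y)` with `B₁`, `B₂`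
symmetric, then `τ(Q) = τ(B₁) + τ(B₂)` (Serre, *A Course in Arithmetic*, Ch. V §1.3.7; Thom
1954, Ch. IV §2, p. 65).  This is the form consumed by the additivity of the signature of
manifolds under disjoint union, where `W`, `V`, `V'` are cohomology groups modulo torsion with
their `ModuleCat` instances. [cite: Serre1973, Ch. V §1.3.7] -/
theorem signature_eq_add_of_maps {W : Type*} [AddCommGroup W] [instW : Module ℤ W]
    [instV : Module ℤ V] [instV' : Module ℤ V'] [Module.Finite ℤ W] [Module.Finite ℤ V]
    [Module.Finite ℤ V'] (Q : LinearMap.BilinForm ℤ W) (B₁ : LinearMap.BilinForm ℤ V)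
    (B₂ : LinearMap.BilinForm ℤ V') (h₁ : B₁.IsSymm) (h₂ : B₂.IsSymm) (π₁ : W →ₗ[ℤ] V)
    (π₂ : W →ₗ[ℤ] V') (hinj : ∀ w, π₁ w = 0 → π₂ w = 0 → w = 0)
    (hsurj : ∀ v v', ∃ w, π₁ w = v ∧ π₂ w = v')
    (hQ : ∀ x y, Q x y = B₁ (π₁ x) (π₁ y) + B₂ (π₂ x) (π₂ y)) :
    Q.signature = B₁.signature + B₂.signature := by
  obtain rfl : instW = AddCommGroup.toIntModule W := Subsingleton.elim _ _
  obtain rfl : instV = AddCommGroup.toIntModule V := Subsingleton.elim _ _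
  obtain rfl : instV' = AddCommGroup.toIntModule V' := Subsingleton.elim _ _
  have hbij : Function.Bijective (π₁.prod π₂) := by
    constructor
    · rw [injective_iff_map_eq_zero]
      intro w hw
      rw [LinearMap.prod_apply, Prod.mk_eq_zero] at hw
      exact hinj w hw.1 hw.2
    · rintro ⟨v, v'⟩
      obtain ⟨w, hw₁, hw₂⟩ := hsurj v v'
      exact ⟨w, Prod.ext hw₁ hw₂⟩
  have hequiv : Q.Equivalent (B₁.prod B₂) :=
    ⟨{ toLinearEquiv := LinearEquiv.ofBijective (π₁.prod π₂) hbij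
       map_app' := fun x y => by
         change (B₁.prod B₂) (π₁ x, π₂ x) (π₁ y, π₂ y) = Q x y
         rw [prod_apply, hQ] }⟩
  rw [signature_eq_of_equivalent hequiv, signature_prod B₁ B₂ h₁ h₂]

end Int

end LinearMap.BilinForm

end
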